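import Summits.QuantumAdvantage.QuantumAdvantage.Theorems.CharDialTransferDialK
import HarnessLib

/-!
# TransferDial N — the leaf at a SINGLE co-dimension: the dichotomy form

Sharpening of part K: the rainbow argument needs thinness only at the two levels `T` and `T − 1`, and level `T − 1` is read off level `T`
(a restriction to `Y' ∖ {w}` is a letter restriction of a restriction to `Y'`, `Model.resN_psi`: `|Φ(Y' ∖ w)| ≤ 2·|Φ(Y')|`).  Hence a row budget
`R` at the SINGLE co-dimension `coDimLevel R = 5(((2R)·(2R))^{2R} + 1) + 1` already bounds rainbow sets (`Model.rainbowBound_level`), and the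
algebraic leaf of the SliceDial carving may be stated as ★ `SliceFewLevelTwoOdd`: for every prime `p ≥ 5` SOME budget `R` bounds, for every
Boolean `f` of `𝔽_p`-degree `≤ 2p − 3`, the number of distinct restrictions of `f` to any `coDimLevel R` coordinates (over all backgrounds).
Kernel consequences: `partnersTwoOdd_of_sliceFewLevel`; modulo the field core PF, `structureLaw_iff_sliceFewLevel_of_PF` and the GAP statement
`sliceFew_iff_level_of_PF : SliceFewTwoOdd ↔ SliceFewLevelTwoOdd` — in words: writing `ρ_p(t)` for the largest restriction count to `t`
coordinates at degree `≤ 2p − 3`, EITHER `ρ_p` is bounded (by `p^{K(p)}`, the structure law) OR `ρ_p(coDimLevel R) > R` for every `R`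
(roughly `ρ_p(t) ≳ log t / log log t` for all large `t`); at degree `2p − 2`, `ρ(t) ≥ 2^{⌊t/2⌋}` (part M).

Tree twin, part N of the decomp-qadv lens-6 g23 addendum (the proof of `rainbowBound_level_aux` is the part-J/K proof with the level-`T − 1`
thinness derived from level `T`).  0 sorry; no `instance`, no `notation`, no `native_decide`.
-/

set_option autoImplicit false
set_option linter.dupNamespace false

namespace Summit.QuantumAdvantage.QuantumAdvantage.Theorems.TransferDial

open Classical
open Finset
open Summit.QuantumAdvantage.AdviceFreeQNC0

/-- The single co-dimension at which a row budget `R` feeds the rainbow argument: `5(((2R)(2R))^{2R} + 1) + 1`. -/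
def coDimLevel (R : ℕ) : ℕ := 5 * (((2 * R) * (2 * R)) ^ (2 * R) + 1) + 1

/-- SLICE-FEW at degree `d`, row budget `R`, for bipartitions of co-dimension EXACTLY `T` (restrictions to `T` coordinates). -/
def SliceFewAtLevel (p : ℕ) [Fact p.Prime] (d R T : ℕ) : Prop :=
  ∀ (m : ℕ) (f : (Fin m → Bool) → Bool), HasDegF p f d → ∀ S : Finset (Fin m), Sᶜ.card = T → rowCount f S ≤ R

/-- ★ THE LEAF IN DICHOTOMY FORM (OPEN): at degree `≤ 2p − 3` some budget `R(p)` bounds the number of restrictions to `coDimLevel R(p)`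
coordinates. -/
def SliceFewLevelTwoOdd : Prop :=
  ∀ (p : ℕ) [Fact p.Prime], 5 ≤ p → ∃ R : ℕ, SliceFewAtLevel p (2 * p - 3) R (coDimLevel R)

/-- The global slice-count statement implies the single-level one (trivial direction). -/
theorem sliceFewLevel_of_sliceFew (h : SliceFewTwoOdd) : SliceFewLevelTwoOdd := by
  intro p _ hp
  obtain ⟨R, hR⟩ := h p hp
  exact ⟨R, fun m f hf S _ => hR m f hf S⟩

namespace Model

open Summit.QuantumAdvantage.QuantumAdvantage.Theorems.TransferDial.HomSys

/-- `RainbowBound` from a row budget `R` at the single co-dimension `5((R₂·R₂)^{R₂}+1)+1`, any `R₂ ≥ 2R` (and `≥ R`). -/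
theorem rainbowBound_level_aux (R R₂ : ℕ) (hR : R ≤ R₂) (hR2 : 2 * R ≤ R₂) :
    ∃ N : ℕ, ∀ (m : ℕ) (f : (Fin m → Bool) → Bool),
      (∀ S : Finset (Fin m), Sᶜ.card = 5 * ((R₂ * R₂) ^ R₂ + 1) + 1 → rowCount f S ≤ R) →
        ∀ Y : Finset (Fin m), Rainbow f Y → Y.card ≤ N := by
  obtain ⟨N, hN⟩ := exists_hom (5 * ((R₂ * R₂) ^ R₂ + 1) + 1) (5 * ((R₂ * R₂) ^ R₂ + 1)) (by omega)
  refine ⟨N, fun m f hthin Y hY => ?_⟩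
  by_contra hlt
  obtain ⟨Y', hY'Y, hcard, hhom⟩ := hN m f Y (by omega)
  -- abbreviations
  have hA : (R₂ * R₂) ^ R₂ < (R₂ * R₂) ^ R₂ + 1 := by omega
  have hhom2 : ∀ ℓ, 2 ≤ ℓ → ℓ ≤ 5 * ((R₂ * R₂) ^ R₂ + 1) + 1 → ∀ W₁, W₁ ⊆ Y' → W₁.card = ℓ →
      ∀ W₂, W₂ ⊆ Y' → W₂.card = ℓ → ∀ ψ, Phi f W₁ ψ ↔ Phi f W₂ ψ := by
    intro ℓ h1 h2 W₁ s1 c1 W₂ s2 c2 ψ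
    apply Phi_iff_of_col_eq f (5 * ((R₂ * R₂) ^ R₂ + 1) + 1) (by omega) (by omega)
    exact hhom ℓ (by omega) h2 W₁ (mem_powersetCard.2 ⟨s1, c1⟩) W₂ (mem_powersetCard.2 ⟨s2, c2⟩)
  -- generalize T
  generalize hT : 5 * ((R₂ * R₂) ^ R₂ + 1) + 1 = T at hcard hhom2
  clear hhom
  have hT5 : 5 * ((R₂ * R₂) ^ R₂ + 1) + 1 ≤ T := by omega
  have hT3 : 3 ≤ T := by omega
  -- the restriction system
  let Ψ : ℕ → ((ℕ → Bool) → Bool) → Prop := fun ℓ ψ => ∃ W, W ⊆ Y' ∧ W.card = ℓ ∧ Phi f W ψ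
  obtain ⟨w, hw⟩ : Y'.Nonempty := by rw [← card_pos]; omega
  have hW₁ : Y'.erase w ⊆ Y' := erase_subset _ _
  have hcW₁ : (Y'.erase w).card = T - 1 := by rw [card_erase_of_mem hw, hcard]
  have hΦt : ∀ ψ, Ψ T ψ ↔ ψ ∈ PhiF f Y' := by
    intro ψ
    constructor
    · rintro ⟨W, hW, hc, hphi⟩
      have : W = Y' := eq_of_subset_of_card_le hW (by rw [hc, hcard])
      subst this
      exact (mem_PhiF f _ ψ).2 hphi
    · intro h; exact ⟨Y', subset_rfl, hcard, (mem_PhiF f _ ψ).1 h⟩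
  have hΦt1 : ∀ ψ, Ψ (T - 1) ψ ↔ ψ ∈ PhiF f (Y'.erase w) := by
    intro ψ
    constructor
    · rintro ⟨W, hW, hc, hphi⟩
      exact (mem_PhiF f _ ψ).2 ((hhom2 (T - 1) (by omega) (by omega) W hW hc (Y'.erase w) hW₁ hcW₁ ψ).1 hphi)
    · intro h; exact ⟨(Y'.erase w), hW₁, hcW₁, (mem_PhiF f _ ψ).1 h⟩
  have hctR : (PhiF f Y').card ≤ R :=
    (card_PhiF_le f Y').trans (hthin _ (by rw [compl_compl, hcard]; omega))
  have hct : (PhiF f Y').card ≤ R₂ := hctR.trans hR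
  -- level `T − 1` is read off level `T`: a restriction to `Y' ∖ {w}` is a letter restriction of a restriction to `Y'`
  have hsub1 : PhiF f (Y'.erase w) ⊆
      ((PhiF f Y') ×ˢ (univ : Finset Bool)).image (fun q => resN (rk Y' w) q.2 q.1) := by
    intro ψ hψ
    rw [mem_PhiF] at hψ
    obtain ⟨b, rfl⟩ := hψ
    rw [mem_image]
    refine ⟨(psi f Y' b, b w), mem_product.2 ⟨(mem_PhiF f _ _).2 ⟨b, rfl⟩, mem_univ _⟩, ?_⟩
    have e := resN_psi f Y' b hw (b w)
    rw [Function.update_eq_self] at e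
    exact e
  have hct1 : (PhiF f (Y'.erase w)).card ≤ R₂ := by
    refine (card_le_card hsub1).trans (card_image_le.trans ?_)
    rw [card_product, card_univ, Fintype.card_bool]
    calc (PhiF f Y').card * 2 ≤ R * 2 := Nat.mul_le_mul_right _ hctR
      _ ≤ R₂ := by omega
  have hclosed : ∀ ψ, Ψ T ψ → ∀ s, s < T → ∀ c, Ψ (T - 1) (resN s c ψ) := by
    rintro ψ ⟨W, hW, hc, ⟨b, rfl⟩⟩ s hs c
    obtain ⟨w, hw, hrk⟩ := exists_rk_eq W s (by omega)
    have e := resN_psi f W b hw c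
    rw [hrk] at e
    rw [e]
    exact ⟨W.erase w, (erase_subset _ _).trans hW, by rw [card_erase_of_mem hw, hc], _, rfl⟩
  have hreads : ∀ ℓ ψ, Ψ ℓ ψ → Reads ℓ ψ := by
    rintro ℓ ψ ⟨W, _, hc, ⟨b, rfl⟩⟩
    rw [← hc]
    exact reads_psi f W b
  have hsurj : ∀ ℓ, 2 ≤ ℓ → ℓ < T → ∀ ψ', Ψ ℓ ψ' → ∀ p, p ≤ ℓ →
      ∃ ψ c, Ψ (ℓ + 1) ψ ∧ resN p c ψ = ψ' := by
    rintro ℓ h1 h2 ψ' ⟨W', hW', hc', hphi'⟩ p hp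
    obtain ⟨W, hW, hcW⟩ := exists_subset_card_eq (show ℓ + 1 ≤ Y'.card by omega)
    obtain ⟨w, hw, hrk⟩ := exists_rk_eq W p (by omega)
    have hcE : (W.erase w).card = ℓ := by rw [card_erase_of_mem hw, hcW]; simp
    have hphi : Phi f (W.erase w) ψ' :=
      (hhom2 ℓ h1 (by omega) W' hW' hc' (W.erase w) ((erase_subset _ _).trans hW) hcE ψ').1 hphi'
    obtain ⟨b', rfl⟩ := hphi
    refine ⟨psi f W b', b' w, ⟨W, hW, hcW, b', rfl⟩, ?_⟩
    have e := resN_psi f W b' hw (b' w)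
    rw [hrk, Function.update_eq_self] at e
    exact e
  have key := level_two_symmetric_of_thin (V := Bool) Ψ R₂ ((R₂ * R₂) ^ R₂ + 1) T hA hT5 (PhiF f Y') (PhiF f (Y'.erase w))
    hΦt hΦt1 hct hct1 hclosed hreads
    (fun ℓ h1 h2 ψ' hψ' => hsurj ℓ h1 h2 ψ' hψ' 0 (by omega))
    (fun ℓ h1 h2 ψ' hψ' => hsurj ℓ h1 h2 ψ' hψ' ℓ le_rfl)
  -- two coordinates of Y' are exchangeable: contradiction with rainbowness
  obtain ⟨i, j, hi, hj, hij⟩ := one_lt_card_iff.1 (show 1 < Y'.card by omega)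
  have main : ∀ i j : Fin m, i ∈ Y' → j ∈ Y' → i < j → False := by
    intro i j hi hj hlt
    apply hY i (hY'Y hi) j (hY'Y hj) (ne_of_lt hlt)
    intro u
    have hsub : ({i, j} : Finset (Fin m)) ⊆ Y' := insert_subset hi (singleton_subset_iff.2 hj)
    have hg : Ψ 2 (psi f {i, j} u) := ⟨{i, j}, hsub, card_pair (ne_of_lt hlt), u, rfl⟩
    have hk := key _ hg (fun k => if k = 0 then u i else u j)
    have e1 : fill {i, j} u (fun k => if k = 0 then u i else u j) = u := by
      funext k
      unfold fill
      by_cases hk : k ∈ ({i, j} : Finset (Fin m))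
      · rw [if_pos hk]
        simp only [mem_insert, mem_singleton] at hk
        rcases hk with rfl | rfl
        · rw [rk_pair_left hlt]; simp
        · rw [rk_pair_right hlt]; simp
      · rw [if_neg hk]
    have e2 : fill {i, j} u (swN 0 1 (fun k => if k = 0 then u i else u j)) = u ∘ Equiv.swap i j := by
      funext k
      unfold fill swN
      by_cases hk : k ∈ ({i, j} : Finset (Fin m))
      · rw [if_pos hk]
        simp only [mem_insert, mem_singleton] at hk
        rcases hk with rfl | rfl
        · rw [rk_pair_left hlt]
          simp [Equiv.swap_apply_left]
        · rw [rk_pair_right hlt]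
          simp [Equiv.swap_apply_right]
      · rw [if_neg hk]
        simp only [mem_insert, mem_singleton, not_or] at hk
        simp only [Function.comp_apply]
        rw [Equiv.swap_apply_of_ne_of_ne hk.1 hk.2]
    unfold psi at hk
    rw [e1, e2] at hk
    exact hk
  rcases lt_or_gt_of_ne hij with hlt | hgt
  · exact main i j hi hj hlt
  · exact main j i hj hi hgt

/-- ★ `RainbowBound` from thinness at the single co-dimension `coDimLevel R`. -/
theorem rainbowBound_level (R : ℕ) : ∃ N : ℕ, ∀ (m : ℕ) (f : (Fin m → Bool) → Bool),
    (∀ S : Finset (Fin m), Sᶜ.card = coDimLevel R → rowCount f S ≤ R) →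
      ∀ Y : Finset (Fin m), Rainbow f Y → Y.card ≤ N :=
  rainbowBound_level_aux R (2 * R) (by omega) le_rfl

end Model

/-- ★★ `PartnersTwoOdd ⟸ SliceFewLevelTwoOdd`. -/
theorem partnersTwoOdd_of_sliceFewLevel (hS : SliceFewLevelTwoOdd) : PartnersTwoOdd := by
  intro p _ hp
  obtain ⟨R, hR⟩ := hS p hp
  obtain ⟨N, hN⟩ := Model.rainbowBound_level R
  refine ⟨N * (3 * p - 2), fun m f hf => ?_⟩
  obtain ⟨L, hLc, hLp⟩ :=
    lonely_le_of_rainbow f N (3 * p - 2) fun Y hY => hN m f (fun S hS' => hR m f hf S hS') Y hY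
  exact ⟨L, hLc, fun i hi => hLp i hi⟩

/-- ★★★ Modulo the field core PF: piece B ⟺ the single-level slice-count statement. -/
theorem structureLaw_iff_sliceFewLevel_of_PF (hPF : FieldCorePerPrime) :
    StructureLawTwoOdd ↔ SliceFewLevelTwoOdd :=
  ⟨fun hB => sliceFewLevel_of_sliceFew (sliceFew_of_structureLaw hB),
   fun hS => closes_of_PF hPF (partnersTwoOdd_of_sliceFewLevel hS)⟩

/-- ★★ THE GAP STATEMENT modulo PF: bounded restriction counts at ONE suitable co-dimension ⟺ bounded row counts for every bipartition. -/
theorem sliceFew_iff_level_of_PF (hPF : FieldCorePerPrime) : SliceFewTwoOdd ↔ SliceFewLevelTwoOdd :=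
  ⟨sliceFewLevel_of_sliceFew,
   fun h => sliceFew_of_structureLaw ((structureLaw_iff_sliceFewLevel_of_PF hPF).2 h)⟩

/-- info: 'Summit.QuantumAdvantage.QuantumAdvantage.Theorems.TransferDial.sliceFew_iff_level_of_PF' depends on axioms: [propext,
 choice,
 Quot.sound] -/
#guard_msgs in #print axioms sliceFew_iff_level_of_PF

end Summit.QuantumAdvantage.QuantumAdvantage.Theorems.TransferDial
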